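import Summits.QuantumFields.YangMills.Theorems.UnitScaleTiltHalvingH59GammaDischargeFlat
import HarnessLib

/-!
# Route `UnitScaleTilt`, crux K1 child «MinimiserStabilityRegPr» (stmt-QuantumFields-19200), registered stub `stub_halvingStep` (v10 `BirthV10`), line H, ROAD γ —
# ★★ «(γ-6) H59-DISCHARGE», COMPOSER SHAPE: THE TOP-LEVEL γ (1.59) CLAUSE OVER PRINT'S SPLIT CLASS `cubeLamBP′` (the `H59γ` binder of the v3 composers
# ✓`HalvingHSiteRowsOfSocketsTGamma(T).siteRows_of_socketsTγ(T)` ∕ ✓`HalvingHSiteRowsOfSocketsBaseTGamma(T).siteRows_of_sockets_baseTγ(T)`, with its idle antecedents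
# `gJ`∕(1.40)∕`InAx`∕tower∕`g′ u`∕unitarity∕support∕`mgauge`∕`Restr129`∕knit∕`IsSelfAdjoint` STRIPPED) IS A THEOREM AT `U₀ = 1` ON PRINT'S p. 98 SUB-LATTICE — the sibling of
# ✓`HalvingH59GammaDischargeFlat.H59TLγ_holds_member` (class `cubeLamBP`) for the composers' class; same three lit theorems.

Cell `ym3-torus` (HUMAN RULING D-0037: YM₃ on T³ is ladder rung R3 — NOT d = 4, NOT a mass gap, NOT the Clay problem), width seat `ym3-torus-px10` gen 3 (LEAD-H ★w5-19200 g6 WORD 28).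
`--supports stmt-QuantumFields-19200 --as helper`; THEOREMS ONLY (0 `def`, 0 `sorry`); count-neutral; nothing here claims `SB9γAllL`, the stub, the crux or the gap.

WHAT IS PROVED (ns `…Theorems.HalvingH59GammaDischargeFlatSplit`): ★★ `H59γ_flat_member (L) (hL : 1 < L)` —
`∃ Bs ρ₀ M₀ N₀ R₀, 1 ≤ Bs ∧ ∀ F (F.L = L) n K (n < K) a M′ ρ′ sx Rx, L ≤ ρ′ → ⟨7 sub-lattice guards⟩ → ∀ B₀ Bbd c, Bs ≤ B₀ → Bs ≤ Bbd → 0 ≤ c → c ≤ 1∕2 → ∀ V′ A′,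
IsLandau138W … (K − n) … 1 V′ → (V′ = e^{iηA′} ∧ ‖A′‖ ≤ c(Lʲη)⁻¹ on side-touching bonds) → support → <the composers' two lines VERBATIM (class cubeLamBP′ … (K−n) (K−n), collar Bbd)>`.
★★ `H59TLγP_holds_member (L) (hL)` — the K-final pack ✓p685244's displayed conjunct `H59TLγ` (ρ4 prefix + composers' `H59γ` body over `cubeLamBP′`) with the
sub-lattice line inserted after `ρ′ = ρ + M + L + S →`, for all socket letters `B₀, Bbd ≥ Bs` — by `H59γ_flat_member` and the window from `hw`.
★★ `H59DγLP_holds_member (L) (hL)` — the K-final STEP pack ✓p685747's displayed conjunct `H59DγL` (ρ4 prefix + the step composer's ∀(W, A′)-closed `H59Dγ` body over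
`cubeLamBP′ … (K−n) (K−n−1)`) with the line «`2 ≤ K − n →` + sub-lattice guards» inserted — by ✓`H59Dβm_holds_member` and `L·c⋆ ≤ 1∕12` from `hw`.
USE (packs v3, BASE k = 1 and STEP k ≥ 2 alike; `K − n ≥ 1` only): open the ∃ once per `L` next to the socket letters, take `B₀ Bbd ≥ Bs`, put `(M′, ρ′)` on the sub-lattice, and
inhabit the composer's `H59γ` by `fun gJ _ _ _ g' u V' A' _ _ _ _ hLan _ h41 h0 => H … V' A' hLan.1 h41 h0` with `c := 2((F.P K).L·c⋆) + 8α₄` (`0 ≤ c` = the composer's `hα₂`,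
`c ≤ 1∕2` ⟸ its `h50`); the per-datum socket `H59Dγ` of the STEP composer is ✓`HalvingH59GammaDischargeFlat.H59Dβm_holds_member` read through `fun W A' _ _ hLan => H … W hLan A'`.

HONEST SCOPE.  By-name composition of lit ✓`ineq159FlatCubeMemberPrinted_holds_L3` → ✓`sc4_cubeMember_of_ineq159Printed` (index ⊇ `cubeLamBP` by ✓`cubeLamBP_sub_splitIndex`) →
✓`twoLine_mono` → ✓`flat159_clause_of_scalar_bdryβ`; the window is print's (p. 98); nothing of Prop. 3 ∕ Thm 4 ∕ `SB9γAllL` ∕ `hSupUρ4` ∕ the stub ∕ the crux is asserted; YM₃ on T³ =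
rung R3 — not d = 4, not Clay, no mass gap.

References: T. Bałaban, CMP **99** (1985) 75–102 [Balaban1985RegularSpaces] ((1.58)–(1.59) p.86, (1.62) p.87, (1.31) p.82, p.98, Thm 4 p.88); CMP **99** (1985) 389–434
[Balaban1985BackgroundPropagators] (Thm 3.3 p.399, (3.47) p.398); CMP **96** (1984) 223–250 [Balaban1984PropagatorsII] ((2.3) p.224).
-/

set_option autoImplicit false

noncomputable section

open scoped BigOperators Matrix.Norms.L2Operator
open NormedSpace
open Complex (I)

namespace Summit.QuantumFields.YangMills.Theorems.HalvingH59GammaDischargeFlatSplit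

open Literature.MathematicalPhysics.QuantumFieldTheory.Balaban1983to89
open Literature.MathematicalPhysics.QuantumFieldTheory.Balaban1983to89.T3ContinuumYM3Torus
open Literature.MathematicalPhysics.QuantumFieldTheory.Balaban1983to89.T3PrintedRegularMinimiser (RegPr regFibrePr)
open B5Eq118OneStroke (iterBlockOf)
open B7Prop1Explicit (e)
open B7Prop1Explicit renaming Site → LSite
open B7Prop2Explicit (unitaryUnits avgIter)
open B7Prop1Local (InBox loK bondHiK)
open B7Eq92Concrete (mgauge)
open B8Ineq130 (tlo thi)
open B8Ineq132 (covDerivFwd InAk BondTouches)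
open B8Eq119TwistedAxial (Restr129 InAx)
open B8Eq131Cubes (tLo tHi)
open B8Eq131CubesAdmissible (cubeFam)
open B8CubeMemberZd (cubeLamS cubeLamB)
open B8Eq184Proof (cfgExp)
open B8Eq140Level (SideTouches)
open B8Eq146AExpansion (iEta)
open B8Eq138LandauZd (IsLandau138 IsLandau138W)
open B7Prop4GeneralLevels (linCovIter)
open B8Eq155JBound (Jcur wsup wsup_nonneg)
open B8ScaledSupNorm (bondNorm msup msup_nonneg)
open B9SupplySockB9P3ZdBeta (CrossB)
open B9SupplySockB9P3ZdGamma (cubeLamBP')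
open B8Ineq159FlatCubeMemberPrinted (cubeLamBP Ineq159FlatCubeMemberPrinted)
open B8Ineq159FlatCubeMemberTransplantL3 (ineq159FlatCubeMemberPrinted_holds_L3)
open B8Ineq159FlatCubeMemberSCGamma (sc4_cubeMember_of_ineq159Printed cubeLamBP_sub_splitIndex)
open B8Ineq159FlatOfScalarBdryBeta (flat159_clause_of_scalar_bdryβ)
open B10Eq27TorusAxialLog (pull pull_apply unitsField toUField gaugeActT)
open B15Eq112TorusCover (cover)
open HalvingH59GammaDischargeFlat (twoLine_mono)
open HalvingHSupURhoWindowsRho3 (exists_topCall_constants_of_rhoWindow₃)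

/-! ## ★★ The composers' top-level γ (1.59) clause over `cubeLamBP′`, discharged on the sub-lattice -/

/-- ★★ **«(γ-6)», COMPOSER SHAPE: THE TOP-LEVEL γ (1.59) CLAUSE OVER `cubeLamBP′` AT `U₀ = 1` IS A THEOREM ON PRINT'S SUB-LATTICE** (the v3 composers' `H59γ` binder with its idle
antecedents stripped; `c` generic — the composers read it at `c := 2((F.P K).L·c⋆) + 8α₄`).  For every `L > 1`: `∃ Bs ρ₀ M₀ N₀ R₀, 1 ≤ Bs ∧ …` as in the module docstring.
[cite: Balaban1985RegularSpaces, (1.58)-(1.59) p.86, (1.62) p.87, (1.31) p.82, p.98, Thm 4 p.88; Balaban1985BackgroundPropagators, Thm 3.3 p.399, (3.47) p.398; Balaban1984PropagatorsII, (2.3) p.224] -/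
theorem H59γ_flat_member (L : ℕ) (hL : 1 < L) :
    ∃ Bs ρ₀ M₀ : ℝ, ∃ N₀ R₀ : ℕ, 1 ≤ Bs ∧
    ∀ (F : T3Family), F.L = L → ∀ (n K : ℕ), n < K →
    ∀ (a : LSite (F.P K).d) (M' ρ' sx Rx : ℕ), L ≤ ρ' →
      M₀ ≤ (L : ℝ) ^ (sx + 1) → L ^ (sx + 1) ∣ ρ' → L ^ (sx + 1) ∣ M' → Rx * L ^ (sx + 1) ≤ ρ' → R₀ ≤ Rx → N₀ + 1 ≤ Rx * L ^ (sx + 1) → ρ₀ ≤ (ρ' : ℝ) →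
    ∀ (B₀ Bbd c : ℝ), Bs ≤ B₀ → Bs ≤ Bbd → 0 ≤ c → c ≤ 1 / 2 →
    ∀ (V' : LSite (F.P K).d → Fin (F.P K).d → (Matrix (Fin 2) (Fin 2) ℂ)ˣ) (A' : LSite (F.P K).d → Fin (F.P K).d → (Matrix (Fin 2) (Fin 2) ℂ)),
      IsLandau138W (F.P K).L (K - n) (((F.L : ℝ)⁻¹) ^ (K - n)) ((cubeFam false (F.P K).L a M' ρ' (K - n)) 0) (cubeLamS (F.P K).L a M' ρ' (K - n) (K - n))
        (1 : LSite (F.P K).d → Fin (F.P K).d → (Matrix (Fin 2) (Fin 2) ℂ)ˣ) V' →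
      (∀ j, j ≤ K - n → ∀ y τ, SideTouches ((cubeFam false (F.P K).L a M' ρ' (K - n)) j) y τ →
        V' y τ = cfgExp (((F.L : ℝ)⁻¹) ^ (K - n)) A' y τ ∧ ‖A' y τ‖ ≤ c * (((F.P K).L : ℝ) ^ j * (((F.L : ℝ)⁻¹) ^ (K - n)))⁻¹) →
      (∀ y τ, (∀ j, j ≤ K - n → ¬ SideTouches ((cubeFam false (F.P K).L a M' ρ' (K - n)) j) y τ) → A' y τ = 0) →
      msup (F.P K).L (K - n) (((F.L : ℝ)⁻¹) ^ (K - n)) (-(1 : ℝ)) (fun j (b : LSite (F.P K).d × Fin (F.P K).d) => SideTouches ((cubeFam false (F.P K).L a M' ρ' (K - n)) j) b.1 b.2) (fun b => A' b.1 b.2)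
          ≤ B₀ * (bondNorm (F.P K).L (K - n) (((F.L : ℝ)⁻¹) ^ (K - n)) (-(3 : ℝ)) (cubeFam false (F.P K).L a M' ρ' (K - n)) (fun x μ => Jcur (((F.L : ℝ)⁻¹) ^ (K - n)) (1 : LSite (F.P K).d → Fin (F.P K).d → (Matrix (Fin 2) (Fin 2) ℂ)ˣ) A' μ x)
            + wsup 1 (fun p : {p : ℕ × (LSite (F.P K).d × Fin (F.P K).d) // p.1 ≤ K - n ∧ (p.2 ∈ (cubeLamBP' (F.P K).L a M' ρ' (K - n) (K - n)) p.1 ∨ (p.1 = 0 ∧ CrossB ((cubeFam false (F.P K).L a M' ρ' (K - n)) 0) p.2))} => linCovIter (F.P K).L (1 : LSite (F.P K).d → Fin (F.P K).d → (Matrix (Fin 2) (Fin 2) ℂ)ˣ) (iEta (((F.L : ℝ)⁻¹) ^ (K - n)) A') p.1.1 p.1.2.1 p.1.2.2))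
            + Bbd * msup (F.P K).L (K - n) (((F.L : ℝ)⁻¹) ^ (K - n)) (-(1 : ℝ)) (fun j (b : LSite (F.P K).d × Fin (F.P K).d) => j = 0 ∧ SideTouches ((cubeFam false (F.P K).L a M' ρ' (K - n)) 0) b.1 b.2 ∧ ¬ BondTouches ((cubeFam false (F.P K).L a M' ρ' (K - n)) 0) b.1 b.2) (fun b => A' b.1 b.2) ∧
        msup (F.P K).L (K - n) (((F.L : ℝ)⁻¹) ^ (K - n)) (-(2 : ℝ)) (fun j (t : Fin (F.P K).d × Fin (F.P K).d × LSite (F.P K).d) => SideTouches ((cubeFam false (F.P K).L a M' ρ' (K - n)) j) t.2.2 t.2.1) (fun t => covDerivFwd (((F.L : ℝ)⁻¹) ^ (K - n)) (1 : LSite (F.P K).d → Fin (F.P K).d → (Matrix (Fin 2) (Fin 2) ℂ)ˣ) t.1 (fun z => A' z t.2.1) t.2.2)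
          ≤ B₀ * (bondNorm (F.P K).L (K - n) (((F.L : ℝ)⁻¹) ^ (K - n)) (-(3 : ℝ)) (cubeFam false (F.P K).L a M' ρ' (K - n)) (fun x μ => Jcur (((F.L : ℝ)⁻¹) ^ (K - n)) (1 : LSite (F.P K).d → Fin (F.P K).d → (Matrix (Fin 2) (Fin 2) ℂ)ˣ) A' μ x)
            + wsup 1 (fun p : {p : ℕ × (LSite (F.P K).d × Fin (F.P K).d) // p.1 ≤ K - n ∧ (p.2 ∈ (cubeLamBP' (F.P K).L a M' ρ' (K - n) (K - n)) p.1 ∨ (p.1 = 0 ∧ CrossB ((cubeFam false (F.P K).L a M' ρ' (K - n)) 0) p.2))} => linCovIter (F.P K).L (1 : LSite (F.P K).d → Fin (F.P K).d → (Matrix (Fin 2) (Fin 2) ℂ)ˣ) (iEta (((F.L : ℝ)⁻¹) ^ (K - n)) A') p.1.1 p.1.2.1 p.1.2.2))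
            + Bbd * msup (F.P K).L (K - n) (((F.L : ℝ)⁻¹) ^ (K - n)) (-(1 : ℝ)) (fun j (b : LSite (F.P K).d × Fin (F.P K).d) => j = 0 ∧ SideTouches ((cubeFam false (F.P K).L a M' ρ' (K - n)) 0) b.1 b.2 ∧ ¬ BondTouches ((cubeFam false (F.P K).L a M' ρ' (K - n)) 0) b.1 b.2) (fun b => A' b.1 b.2) := by
  classical
  have hL1 : 1 ≤ L := hL.le
  by_cases hodd : Odd L
  · obtain ⟨ℓ, hℓ⟩ : ∃ ℓ, L = ℓ + 1 := ⟨L - 1, by omega⟩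
    have h159 : Ineq159FlatCubeMemberPrinted 3 L := by
      rw [hℓ]; exact ineq159FlatCubeMemberPrinted_holds_L3 2 ℓ (by omega) (hℓ ▸ hodd)
    obtain ⟨B₀l, ρ₀, M₀, N₀, R₀, hB₀l, H⟩ := sc4_cubeMember_of_ineq159Printed (d := 3) (by norm_num) hL1 h159
    refine ⟨B₀l, ρ₀, M₀, N₀, R₀, hB₀l, ?_⟩
    intro F hF n K hnK a M' ρ' sx Rx hρL hM₀ hdρ hdM hRρ hR₀ hN₀ hρ₀ B₀ Bbd c hB hBbd hc0 hc V' A' hLan h41 h0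
    subst hF
    have hη : 0 < ((F.L : ℝ)⁻¹) ^ (K - n) := by
      have hL0 : (0 : ℝ) < F.L := by exact_mod_cast (F.P K).L_pos
      positivity
    have hk : 1 ≤ K - n := by omega
    have hρ1 : 1 ≤ ρ' := le_trans hL1 hρL
    have hI := cubeLamBP_sub_splitIndex (d := (F.P K).d) hL1 a M' hρ1 hk le_rfl
    have SCALAR : ∀ φ : LSite (F.P K).d → Fin (F.P K).d → ℂ,
        IsLandau138 (F.P K).L (K - n) (((F.L : ℝ)⁻¹) ^ (K - n)) ((fun j => cubeFam false (F.P K).L a M' ρ' (K - n) j) 0)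
          (cubeLamS (F.P K).L a M' ρ' (K - n) (K - n)) (1 : LSite (F.P K).d → Fin (F.P K).d → ℂˣ) φ →
        (∀ (y : LSite (F.P K).d) (τ : Fin (F.P K).d), (∀ j, j ≤ K - n → ¬ SideTouches ((fun j => cubeFam false (F.P K).L a M' ρ' (K - n) j) j) y τ) → φ y τ = 0) →
        msup (F.P K).L (K - n) (((F.L : ℝ)⁻¹) ^ (K - n)) (-(1 : ℝ)) (fun j (b : LSite (F.P K).d × Fin (F.P K).d) => SideTouches ((fun j => cubeFam false (F.P K).L a M' ρ' (K - n) j) j) b.1 b.2) (fun b => φ b.1 b.2)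
            ≤ B₀ * (bondNorm (F.P K).L (K - n) (((F.L : ℝ)⁻¹) ^ (K - n)) (-(3 : ℝ)) (fun j => cubeFam false (F.P K).L a M' ρ' (K - n) j) (fun x μ => Jcur (((F.L : ℝ)⁻¹) ^ (K - n)) (1 : LSite (F.P K).d → Fin (F.P K).d → ℂˣ) φ μ x)
              + wsup 1 (fun p : {p : ℕ × (LSite (F.P K).d × Fin (F.P K).d) // p.1 ≤ K - n ∧ (p.2 ∈ (fun j => cubeLamBP' (F.P K).L a M' ρ' (K - n) (K - n) j) p.1 ∨ (p.1 = 0 ∧ CrossB ((fun j => cubeFam false (F.P K).L a M' ρ' (K - n) j) 0) p.2))} =>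
                  linCovIter (F.P K).L (1 : LSite (F.P K).d → Fin (F.P K).d → ℂˣ) (iEta (((F.L : ℝ)⁻¹) ^ (K - n)) φ) p.1.1 p.1.2.1 p.1.2.2))
              + Bbd * msup (F.P K).L (K - n) (((F.L : ℝ)⁻¹) ^ (K - n)) (-(1 : ℝ)) (fun j (b : LSite (F.P K).d × Fin (F.P K).d) => j = 0 ∧ SideTouches ((fun j => cubeFam false (F.P K).L a M' ρ' (K - n) j) 0) b.1 b.2 ∧ ¬ BondTouches ((fun j => cubeFam false (F.P K).L a M' ρ' (K - n) j) 0) b.1 b.2)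
                  (fun b => φ b.1 b.2) ∧
          msup (F.P K).L (K - n) (((F.L : ℝ)⁻¹) ^ (K - n)) (-(2 : ℝ)) (fun j (t : Fin (F.P K).d × Fin (F.P K).d × LSite (F.P K).d) => SideTouches ((fun j => cubeFam false (F.P K).L a M' ρ' (K - n) j) j) t.2.2 t.2.1)
              (fun t => covDerivFwd (((F.L : ℝ)⁻¹) ^ (K - n)) (1 : LSite (F.P K).d → Fin (F.P K).d → ℂˣ) t.1 (fun z => φ z t.2.1) t.2.2)
            ≤ B₀ * (bondNorm (F.P K).L (K - n) (((F.L : ℝ)⁻¹) ^ (K - n)) (-(3 : ℝ)) (fun j => cubeFam false (F.P K).L a M' ρ' (K - n) j) (fun x μ => Jcur (((F.L : ℝ)⁻¹) ^ (K - n)) (1 : LSite (F.P K).d → Fin (F.P K).d → ℂˣ) φ μ x)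
              + wsup 1 (fun p : {p : ℕ × (LSite (F.P K).d × Fin (F.P K).d) // p.1 ≤ K - n ∧ (p.2 ∈ (fun j => cubeLamBP' (F.P K).L a M' ρ' (K - n) (K - n) j) p.1 ∨ (p.1 = 0 ∧ CrossB ((fun j => cubeFam false (F.P K).L a M' ρ' (K - n) j) 0) p.2))} =>
                  linCovIter (F.P K).L (1 : LSite (F.P K).d → Fin (F.P K).d → ℂˣ) (iEta (((F.L : ℝ)⁻¹) ^ (K - n)) φ) p.1.1 p.1.2.1 p.1.2.2))
              + Bbd * msup (F.P K).L (K - n) (((F.L : ℝ)⁻¹) ^ (K - n)) (-(1 : ℝ)) (fun j (b : LSite (F.P K).d × Fin (F.P K).d) => j = 0 ∧ SideTouches ((fun j => cubeFam false (F.P K).L a M' ρ' (K - n) j) 0) b.1 b.2 ∧ ¬ BondTouches ((fun j => cubeFam false (F.P K).L a M' ρ' (K - n) j) 0) b.1 b.2)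
                  (fun b => φ b.1 b.2) := by
      intro φ hLanφ hsuppφ
      obtain ⟨q1, q2, -, -⟩ := H _ hη a M' ρ' (K - n) sx Rx hk hρL hM₀ hdρ hdM hRρ hR₀ hN₀ hρ₀ (K - n) hk le_rfl
        (fun j c => c ∈ cubeLamBP' (F.P K).L a M' ρ' (K - n) (K - n) j ∨ (j = 0 ∧ CrossB (cubeFam false (F.P K).L a M' ρ' (K - n) 0) c)) hI φ hLanφ hsuppφ
      exact twoLine_mono (msup_nonneg _ _ hη.le _ _ _) (wsup_nonneg zero_le_one _) (msup_nonneg _ _ hη.le _ _ _) hB hBbd ⟨q1, q2⟩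
    exact flat159_clause_of_scalar_bdryβ (𝔸 := Matrix (Fin 2) (Fin 2) ℂ) (d := (F.P K).d) (by rw [T3Family.P_d]; norm_num) hL1 hη (K - n)
      (fun j => cubeFam false (F.P K).L a M' ρ' (K - n) j) (cubeLamS (F.P K).L a M' ρ' (K - n) (K - n))
      (fun j => cubeLamBP' (F.P K).L a M' ρ' (K - n) (K - n) j) (le_trans zero_le_one (hB₀l.trans hB)) (le_trans zero_le_one (hB₀l.trans hBbd)) hc0 hc
      SCALAR V' A' hLan h41 h0
  · refine ⟨1, 0, 0, 0, 0, le_rfl, fun F hF => ?_⟩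
    exact absurd (hF ▸ F.hL.1) hodd


/-! ## ★★ The K-final pack's displayed conjunct `H59TLγ` (ρ4 member prefix + the composers' `H59γ` body), windowed, discharged -/

/-- ★★ **«(γ-6)», PACK SHAPE: the conjunct `H59TLγ` displayed by ✓p685244 `HalvingHMemberPackBaseOfSocketsTGammaT.memberPack_base_of_socketsTγT`'s socket `hSockets₁γ`
(= ✓p672054's ρ4 member prefix + the v3 composers' `H59γ` body over `cubeLamBP′`, bytes :96–131 there) IS A THEOREM once the sub-lattice line is inserted after
`ρ′ = ρ + M + L + S →`** — for all socket letters `B₀, Bbd ≥ Bs`, `0 < B₀'H`, `0 ≤ B₂' BG BR`, `0 < cB9`; `c = 2((F.P K).L·c⋆) + 8α₄ ≤ 1∕16` from `hw` (✓`exists_topCall_constants_of_rhoWindow₃` (2));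
the rest is `H59γ_flat_member`.
[cite: Balaban1985RegularSpaces, (1.58)-(1.59) p.86, (1.62) p.87, (1.31) p.82, p.98, Prop. 3 p.87; Balaban1985BackgroundPropagators, Thm 3.3 p.399, (3.47) p.398; Balaban1984PropagatorsII, (2.3) p.224] -/
theorem H59TLγP_holds_member (L : ℕ) (hL : 1 < L) :
    ∃ Bs ρ₀ M₀ : ℝ, ∃ N₀ R₀ : ℕ, 1 ≤ Bs ∧
    ∀ (M' : ℕ) (B₀ B₀'H B₂' BG BR cB9 Bbd : ℝ), Bs ≤ B₀ → Bs ≤ Bbd → 0 < B₀'H → 0 ≤ B₂' → 0 ≤ BG → 0 ≤ BR → 0 < cB9 →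
    (∀ (F : T3Family), F.L = L → ∀ (n K : ℕ) (hnK : n < K) (ρ S M ρ' : ℕ), ρ' = ρ + M + L + S →
      -- THE SUB-LATTICE WINDOW (print p. 98): the cube datum `(M′, ρ′)` on the big-block sub-lattice of the lit thresholds `ρ₀ M₀ N₀ R₀`
      ∀ (sx Rx : ℕ), M₀ ≤ (L : ℝ) ^ (sx + 1) → L ^ (sx + 1) ∣ ρ' → L ^ (sx + 1) ∣ M' → Rx * L ^ (sx + 1) ≤ ρ' → R₀ ≤ Rx → N₀ + 1 ≤ Rx * L ^ (sx + 1) → ρ₀ ≤ (ρ' : ℝ) →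
      1 ≤ M → 2 ≤ S → ∀ (a₅ Cr ε₀ ε₁ : ℝ), 0 < Cr → 4 < Cr → 12 * ((ρ : ℝ) + (M : ℝ)) * a₅ ≤ Cr → 0 < ε₁ → 0 < ε₀ → ε₀ ≤ a₅ → Cr * ε₁ ≤ ε₀ →
      (10 : ℝ) ^ 29 * (L : ℝ) ^ 12 * (1 + B₀ + B₀⁻¹) ^ 2 * ((1 + B₀'H) * (1 + B₂') * (1 + BG) * (1 + BR)) ^ 5 * (1 + cB9⁻¹) * ((((ρ + M + L + S : ℕ) : ℝ) + (M' : ℝ) + 1) ^ 3 * ε₀) ≤ 1 →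
      2 * ρ + (M' + 1 + 2 * (M + L + S)) ≤ F.L ^ (F.m + n) → ∀ (V : GaugeField (F.P n) 0 (Matrix.specialUnitaryGroup (Fin 2) ℂ)), PlaqSmall ε₁ V → ∀ U ∈ regFibrePr F n K hnK.le ε₀ V,
      ∀ (x₀ : Site (F.P K) 0) (t : ℤ), 0 ≤ t → t ≤ (M' : ℤ) - 1 → ∀ (a : LSite (F.P K).d), a = (fun μ => ((iterBlockOf (K - n) x₀ μ).val : ℤ) - t) →
      ∀ (α₁ α₄ cstar : ℝ), α₁ = 198 * (((ρ' : ℝ) + M' + 1) * ε₀) + 27 * (((ρ' : ℝ) + M' + 1) * ε₀) / ((L : ℝ) * B₀) → cstar = 5 * (F.P K).d * (F.P K).L * B₀ * (ε₀ + α₁) →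
      α₄ = 8 * (300 * (L : ℝ) * ((3 * (M' + ρ') + 1 : ℕ) : ℝ) * (B₀'H + 15 * (L : ℝ) ^ 2 * BG * BR + 3 * BG * BR * B₂')) * (5 * ((3 : ℕ) : ℝ) * L * B₀) * (ε₀ + α₁) → ∀ (s : ℝ), s = (198 + 12 * (((M' : ℝ) - 1) + 4 * ρ')) * ε₀ →
      ∀ (gJ : GaugeTransf (F.P K) 0 (Matrix.specialUnitaryGroup (Fin 2) ℂ)),
      InAk (F.P K).L (K - n) (((F.L : ℝ)⁻¹) ^ (K - n)) ε₀ (fun _ => (Set.univ : Set (LSite (F.P K).d))) (pull (unitsField (toUField (GaugeField.gaugeAct gJ U))) 0) →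
      (∀ m', m' ≤ K - n → ∀ Λ : ℕ → Set (LSite (F.P K).d), InAx (F.P K).L m' Λ (1 : LSite (F.P K).d → Fin (F.P K).d → (Matrix (Fin 2) (Fin 2) ℂ)ˣ) (pull (unitsField (toUField (GaugeField.gaugeAct gJ U))) 0)) →
      (∀ m', m' ≤ K - n → ∀ (x : LSite (F.P K).d) (ν : Fin (F.P K).d), tlo (F.P K).L (tLo a ρ') m' ≤ x → x + e ν ≤ thi (F.P K).L (tHi a M' ρ') m' →
      ‖((avgIter (F.P K).L (pull (unitsField (toUField (GaugeField.gaugeAct gJ U))) 0) (K - n - m') x ν : (Matrix (Fin 2) (Fin 2) ℂ)ˣ) :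
      Matrix (Fin 2) (Fin 2) ℂ) - 1‖ < s) →
      ∀ (g' : GaugeTransf (F.P K) 0 (Matrix (Fin 2) (Fin 2) ℂ)ˣ) (u : LSite (F.P K).d → (Matrix (Fin 2) (Fin 2) ℂ)ˣ) (V' : LSite (F.P K).d → Fin (F.P K).d → (Matrix (Fin 2) (Fin 2) ℂ)ˣ)
      (A' : LSite (F.P K).d → Fin (F.P K).d → (Matrix (Fin 2) (Fin 2) ℂ)),
      (∀ x, u x ∈ unitaryUnits (Matrix (Fin 2) (Fin 2) ℂ)) → (∀ x, x ∉ (cubeFam false (F.P K).L a M' ρ' (K - n)) 0 → u x = 1) →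
      mgauge (1 : LSite (F.P K).d → Fin (F.P K).d → (Matrix (Fin 2) (Fin 2) ℂ)ˣ) u V' = (pull (unitsField (toUField (GaugeField.gaugeAct gJ U))) 0) →
      Restr129 (F.P K).L (K - n) (Function.update (cubeLamS (F.P K).L a M' ρ' (K - n) (K - n)) (K - n) ∅) (1 : LSite (F.P K).d → Fin (F.P K).d → (Matrix (Fin 2) (Fin 2) ℂ)ˣ) u →
      (IsLandau138W (F.P K).L (K - n) (((F.L : ℝ)⁻¹) ^ (K - n)) ((cubeFam false (F.P K).L a M' ρ' (K - n)) 0) (cubeLamS (F.P K).L a M' ρ' (K - n) (K - n)) (1 : LSite (F.P K).d → Fin (F.P K).d → (Matrix (Fin 2) (Fin 2) ℂ)ˣ) V' ∧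
      (∀ c ∈ (cubeLamBP' (F.P K).L a M' ρ' (K - n) (K - n)) (K - n), ∀ (y : LSite (F.P K).d) (τ : Fin (F.P K).d),
      InBox (loK (F.P K).L (K - n) c.1) (bondHiK (F.P K).L (K - n) c.1 c.2) y → InBox (loK (F.P K).L (K - n) c.1) (bondHiK (F.P K).L (K - n) c.1 c.2) (y + e τ) →
      V' y τ = gaugeActT g' (unitsField (toUField U)) ⟨cover (F.P K) y, τ⟩)) →
      (∀ y τ, IsSelfAdjoint (A' y τ)) →
      (∀ j, j ≤ K - n → ∀ y τ, SideTouches ((cubeFam false (F.P K).L a M' ρ' (K - n)) j) y τ →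
      V' y τ = cfgExp (((F.L : ℝ)⁻¹) ^ (K - n)) A' y τ ∧ ‖A' y τ‖ ≤ (2 * ((F.P K).L * cstar) + 8 * α₄) * (((F.P K).L : ℝ) ^ j * (((F.L : ℝ)⁻¹) ^ (K - n)))⁻¹) →
      (∀ y τ, (∀ j, j ≤ K - n → ¬ SideTouches ((cubeFam false (F.P K).L a M' ρ' (K - n)) j) y τ) → A' y τ = 0) →
      msup (F.P K).L (K - n) (((F.L : ℝ)⁻¹) ^ (K - n)) (-(1 : ℝ)) (fun j (b : LSite (F.P K).d × Fin (F.P K).d) => SideTouches ((cubeFam false (F.P K).L a M' ρ' (K - n)) j) b.1 b.2) (fun b => A' b.1 b.2)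
      ≤ B₀ * (bondNorm (F.P K).L (K - n) (((F.L : ℝ)⁻¹) ^ (K - n)) (-(3 : ℝ)) (cubeFam false (F.P K).L a M' ρ' (K - n)) (fun x μ => Jcur (((F.L : ℝ)⁻¹) ^ (K - n)) (1 : LSite (F.P K).d → Fin (F.P K).d → (Matrix (Fin 2) (Fin 2) ℂ)ˣ) A' μ x)
      + wsup 1 (fun p : {p : ℕ × (LSite (F.P K).d × Fin (F.P K).d) // p.1 ≤ K - n ∧ (p.2 ∈ (cubeLamBP' (F.P K).L a M' ρ' (K - n) (K - n)) p.1 ∨ (p.1 = 0 ∧ CrossB ((cubeFam false (F.P K).L a M' ρ' (K - n)) 0) p.2))} =>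
      linCovIter (F.P K).L (1 : LSite (F.P K).d → Fin (F.P K).d → (Matrix (Fin 2) (Fin 2) ℂ)ˣ) (iEta (((F.L : ℝ)⁻¹) ^ (K - n)) A') p.1.1 p.1.2.1 p.1.2.2))
      + Bbd * msup (F.P K).L (K - n) (((F.L : ℝ)⁻¹) ^ (K - n)) (-(1 : ℝ)) (fun j (b : LSite (F.P K).d × Fin (F.P K).d) => j = 0 ∧ SideTouches ((cubeFam false (F.P K).L a M' ρ' (K - n)) 0) b.1 b.2 ∧ ¬ BondTouches ((cubeFam false (F.P K).L a M' ρ' (K - n)) 0) b.1 b.2) (fun b => A' b.1 b.2) ∧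
      msup (F.P K).L (K - n) (((F.L : ℝ)⁻¹) ^ (K - n)) (-(2 : ℝ)) (fun j (t : Fin (F.P K).d × Fin (F.P K).d × LSite (F.P K).d) => SideTouches ((cubeFam false (F.P K).L a M' ρ' (K - n)) j) t.2.2 t.2.1)
      (fun t => covDerivFwd (((F.L : ℝ)⁻¹) ^ (K - n)) (1 : LSite (F.P K).d → Fin (F.P K).d → (Matrix (Fin 2) (Fin 2) ℂ)ˣ) t.1 (fun z => A' z t.2.1) t.2.2)
      ≤ B₀ * (bondNorm (F.P K).L (K - n) (((F.L : ℝ)⁻¹) ^ (K - n)) (-(3 : ℝ)) (cubeFam false (F.P K).L a M' ρ' (K - n)) (fun x μ => Jcur (((F.L : ℝ)⁻¹) ^ (K - n)) (1 : LSite (F.P K).d → Fin (F.P K).d → (Matrix (Fin 2) (Fin 2) ℂ)ˣ) A' μ x)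
      + wsup 1 (fun p : {p : ℕ × (LSite (F.P K).d × Fin (F.P K).d) // p.1 ≤ K - n ∧ (p.2 ∈ (cubeLamBP' (F.P K).L a M' ρ' (K - n) (K - n)) p.1 ∨ (p.1 = 0 ∧ CrossB ((cubeFam false (F.P K).L a M' ρ' (K - n)) 0) p.2))} =>
      linCovIter (F.P K).L (1 : LSite (F.P K).d → Fin (F.P K).d → (Matrix (Fin 2) (Fin 2) ℂ)ˣ) (iEta (((F.L : ℝ)⁻¹) ^ (K - n)) A') p.1.1 p.1.2.1 p.1.2.2))
      + Bbd * msup (F.P K).L (K - n) (((F.L : ℝ)⁻¹) ^ (K - n)) (-(1 : ℝ)) (fun j (b : LSite (F.P K).d × Fin (F.P K).d) => j = 0 ∧ SideTouches ((cubeFam false (F.P K).L a M' ρ' (K - n)) 0) b.1 b.2 ∧ ¬ BondTouches ((cubeFam false (F.P K).L a M' ρ' (K - n)) 0) b.1 b.2) (fun b => A' b.1 b.2)) := by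
  classical
  obtain ⟨Bs, ρ₀, M₀, N₀, R₀, hBs, H⟩ := H59γ_flat_member L hL
  refine ⟨Bs, ρ₀, M₀, N₀, R₀, hBs, ?_⟩
  intro M' B₀ B₀'H B₂' BG BR cB9 Bbd hB hBbd hB₀'H hB₂' hBG hBR hcB9 F hF n K hnK ρ S M ρ' hρ'def sx Rx hM₀ hdρ hdM hRρ hR₀ hN₀ hρ₀ _hM _hS a₅ Cr ε₀ ε₁ _hCr _hCr4
    _h12 _hε₁ hε₀ _hε₀a _hCrε hw _hroom V _hV U _hU x₀ t _ht0 _ht a _hadef α₁ α₄ cstar hα₁def hcdef hα₄def s _hsdef gJ _hInAk _hInAx _htw g' u V' A' _hu _huS _hW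
    _h129 hLan _hsa h41 h0
  -- letters of the member and the window tuple `16·(2(L·c⋆) + 8α₄) ≤ 1`
  have hd3 : (F.P K).d = 3 := T3Family.P_d F K
  have hLF : (F.P K).L = F.L := rfl
  have hL2P : 2 ≤ (F.P K).L := by rw [hLF, hF]; omega
  have hLr : ((F.P K).L : ℝ) = (L : ℝ) := by rw [hLF, hF]
  have hB₀ : 0 < B₀ := lt_of_lt_of_le one_pos (hBs.trans hB)
  have hw' := hw
  rw [← hLr] at hw'
  subst hρ'def
  obtain ⟨m₀, α₀, α₁', a₆₆, cstar', B₀', α₄', C₂, cB, cA, cDA, c', σ, δ, ω, Cb, Cl, τ₀, e0, eα₀, ea, e1, ec, eB, e4, eC, ecB, ecA, ecDA, ecp, eσ, eδ, eω, eτ₀,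
    ⟨-, -, -, -, -, -, -, hα₄0, -, -, hc0', -⟩, ⟨-, -, -, -, -, -, h16, -⟩, -, -⟩ :=
    exists_topCall_constants_of_rhoWindow₃ (F.P K).d (F.P K).L hd3 hL2P hB₀ hB₀'H hB₂' hBG hBR hcB9 M' (ρ + M + L + S) hε₀ hw'
  have hα₁E : α₁ = α₁' := by rw [hα₁def, e1, hLr]
  have hcE : cstar = cstar' := by rw [hcdef, ec, eα₀, hα₁E]
  have hα₄E : α₄ = α₄' := by rw [hα₄def, e4, eB, e0, eα₀, hα₁E, hd3, hLr]
  rw [← hcE, ← hα₄E] at h16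
  rw [← hcE] at hc0'
  rw [← hα₄E] at hα₄0
  have hLP0 : (0 : ℝ) ≤ ((F.P K).L : ℝ) := Nat.cast_nonneg _
  have hc0 : 0 ≤ 2 * ((F.P K).L * cstar) + 8 * α₄ := by
    have h1 : 0 ≤ ((F.P K).L : ℝ) * cstar := mul_nonneg hLP0 hc0'
    linarith only [h1, hα₄0]
  have hc : 2 * ((F.P K).L * cstar) + 8 * α₄ ≤ 1 / 2 := by linarith only [h16, hc0]
  have hρL : L ≤ ρ + M + L + S := by omega
  exact H F hF n K hnK a M' (ρ + M + L + S) sx Rx hρL hM₀ hdρ hdM hRρ hR₀ hN₀ hρ₀ B₀ Bbd _ hB hBbd hc0 hc V' A' hLan.1 h41 h0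


/-! ## ★★ The K-final step pack's displayed conjunct `H59DγL` (ρ4 member prefix + the composers' per-datum `H59Dγ` body), windowed, discharged -/

/-- ★★ **«(γ-6)», PACK SHAPE, PER DATUM: the conjunct `H59DγL` displayed by ✓p685747 `HalvingHMemberPackStepOfSocketsTGammaT.memberPack_step_of_socketsTγT`'s socket `hSockets₂γ`
(= the ρ4 member prefix + the v3 step composer's ∀(W, A′)-closed `H59Dγ` body over `cubeLamBP′ … (K−n) (K−n−1)`) IS A THEOREM once the line «`2 ≤ K − n →` + the seven sub-lattice
guards» is inserted after `ρ′ = ρ + M + L + S →`** — for all socket letters `B₀, Bbd ≥ Bs`, `0 < B₀'H`, `0 ≤ B₂' BG BR`, `0 < cB9`; `c⋆ ≤ L·c⋆ ≤ 1∕12` from `hw`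
(✓`exists_topCall_constants_of_rhoWindow₃` (2)); the rest is ✓`HalvingH59GammaDischargeFlat.H59Dβm_holds_member`.
[cite: Balaban1985RegularSpaces, (1.58)-(1.59) p.86, (1.62) p.87, (1.31) p.82, p.98, Thm 4 p.88; Balaban1985BackgroundPropagators, Thm 3.3 p.399, (3.47) p.398; Balaban1984PropagatorsII, (2.3) p.224] -/
theorem H59DγLP_holds_member (L : ℕ) (hL : 1 < L) :
    ∃ Bs ρ₀ M₀ : ℝ, ∃ N₀ R₀ : ℕ, 1 ≤ Bs ∧
    ∀ (M' : ℕ) (B₀ B₀'H B₂' BG BR cB9 Bbd : ℝ), Bs ≤ B₀ → Bs ≤ Bbd → 0 < B₀'H → 0 ≤ B₂' → 0 ≤ BG → 0 ≤ BR → 0 < cB9 →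
    (∀ (F : T3Family), F.L = L → ∀ (n K : ℕ) (hnK : n < K) (ρ S M ρ' : ℕ), ρ' = ρ + M + L + S →
      -- THE SUB-LATTICE WINDOW (print p. 98) + the step guard `2 ≤ K − n`: the cube datum `(M′, ρ′)` on the big-block sub-lattice of the lit thresholds `ρ₀ M₀ N₀ R₀`
      2 ≤ K - n → ∀ (sx Rx : ℕ), M₀ ≤ (L : ℝ) ^ (sx + 1) → L ^ (sx + 1) ∣ ρ' → L ^ (sx + 1) ∣ M' → Rx * L ^ (sx + 1) ≤ ρ' → R₀ ≤ Rx → N₀ + 1 ≤ Rx * L ^ (sx + 1) → ρ₀ ≤ (ρ' : ℝ) →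
      1 ≤ M → 2 ≤ S → ∀ (a₅ Cr ε₀ ε₁ : ℝ), 0 < Cr → 4 < Cr → 12 * ((ρ : ℝ) + (M : ℝ)) * a₅ ≤ Cr → 0 < ε₁ → 0 < ε₀ → ε₀ ≤ a₅ → Cr * ε₁ ≤ ε₀ →
      (10 : ℝ) ^ 29 * (L : ℝ) ^ 12 * (1 + B₀ + B₀⁻¹) ^ 2 * ((1 + B₀'H) * (1 + B₂') * (1 + BG) * (1 + BR)) ^ 5 * (1 + cB9⁻¹) * ((((ρ + M + L + S : ℕ) : ℝ) + (M' : ℝ) + 1) ^ 3 * ε₀) ≤ 1 →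
      2 * ρ + (M' + 1 + 2 * (M + L + S)) ≤ F.L ^ (F.m + n) → ∀ (V : GaugeField (F.P n) 0 (Matrix.specialUnitaryGroup (Fin 2) ℂ)), PlaqSmall ε₁ V → ∀ U ∈ regFibrePr F n K hnK.le ε₀ V,
      ∀ (x₀ : Site (F.P K) 0) (t : ℤ), 0 ≤ t → t ≤ (M' : ℤ) - 1 → ∀ (a : LSite (F.P K).d), a = (fun μ => ((iterBlockOf (K - n) x₀ μ).val : ℤ) - t) →
      ∀ (α₁ α₄ cstar : ℝ), α₁ = 198 * (((ρ' : ℝ) + M' + 1) * ε₀) + 27 * (((ρ' : ℝ) + M' + 1) * ε₀) / ((L : ℝ) * B₀) → cstar = 5 * (F.P K).d * (F.P K).L * B₀ * (ε₀ + α₁) →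
      α₄ = 8 * (300 * (L : ℝ) * ((3 * (M' + ρ') + 1 : ℕ) : ℝ) * (B₀'H + 15 * (L : ℝ) ^ 2 * BG * BR + 3 * BG * BR * B₂')) * (5 * ((3 : ℕ) : ℝ) * L * B₀) * (ε₀ + α₁) → ∀ (s : ℝ), s = (198 + 12 * (((M' : ℝ) - 1) + 4 * ρ')) * ε₀ →
      ∀ (W : LSite (F.P K).d → Fin (F.P K).d → (Matrix (Fin 2) (Fin 2) ℂ)ˣ) (A' : LSite (F.P K).d → Fin (F.P K).d → (Matrix (Fin 2) (Fin 2) ℂ)),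
      (∀ x κ, W x κ ∈ unitaryUnits (Matrix (Fin 2) (Fin 2) ℂ)) → InAk (F.P K).L (K - n - 1) (((F.L : ℝ)⁻¹) ^ (K - n)) ε₀ (cubeFam false (F.P K).L a M' ρ' (K - n)) W →
      IsLandau138W (F.P K).L (K - n - 1) (((F.L : ℝ)⁻¹) ^ (K - n)) ((cubeFam false (F.P K).L a M' ρ' (K - n)) 0) (cubeLamS (F.P K).L a M' ρ' (K - n) (K - n - 1)) (1 : LSite (F.P K).d → Fin (F.P K).d → (Matrix (Fin 2) (Fin 2) ℂ)ˣ) W →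
      (∀ y τ, IsSelfAdjoint (A' y τ)) → (∀ j, j ≤ K - n - 1 → ∀ (y : LSite (F.P K).d) (τ : Fin (F.P K).d), SideTouches ((cubeFam false (F.P K).L a M' ρ' (K - n)) j) y τ → W y τ = cfgExp (((F.L : ℝ)⁻¹) ^ (K - n)) A' y τ ∧ ‖A' y τ‖ ≤ cstar * (((F.P K).L : ℝ) ^ j * (((F.L : ℝ)⁻¹) ^ (K - n)))⁻¹) →
      (∀ (y : LSite (F.P K).d) (τ : Fin (F.P K).d), (∀ j, j ≤ K - n - 1 → ¬ SideTouches ((cubeFam false (F.P K).L a M' ρ' (K - n)) j) y τ) → A' y τ = 0) →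
      msup (F.P K).L (K - n - 1) (((F.L : ℝ)⁻¹) ^ (K - n)) (-(1 : ℝ)) (fun j (b : LSite (F.P K).d × Fin (F.P K).d) => SideTouches ((cubeFam false (F.P K).L a M' ρ' (K - n)) j) b.1 b.2) (fun b => A' b.1 b.2)
          ≤ B₀ * (bondNorm (F.P K).L (K - n - 1) (((F.L : ℝ)⁻¹) ^ (K - n)) (-(3 : ℝ)) (cubeFam false (F.P K).L a M' ρ' (K - n)) (fun x μ => Jcur (((F.L : ℝ)⁻¹) ^ (K - n)) (1 : LSite (F.P K).d → Fin (F.P K).d → (Matrix (Fin 2) (Fin 2) ℂ)ˣ) A' μ x)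
            + wsup 1 (fun p : {p : ℕ × (LSite (F.P K).d × Fin (F.P K).d) // p.1 ≤ K - n - 1 ∧ (p.2 ∈ (cubeLamBP' (F.P K).L a M' ρ' (K - n) (K - n - 1)) p.1 ∨ (p.1 = 0 ∧ CrossB ((cubeFam false (F.P K).L a M' ρ' (K - n)) 0) p.2))} => linCovIter (F.P K).L (1 : LSite (F.P K).d → Fin (F.P K).d → (Matrix (Fin 2) (Fin 2) ℂ)ˣ) (iEta (((F.L : ℝ)⁻¹) ^ (K - n)) A') p.1.1 p.1.2.1 p.1.2.2))
            + Bbd * msup (F.P K).L (K - n - 1) (((F.L : ℝ)⁻¹) ^ (K - n)) (-(1 : ℝ)) (fun j (b : LSite (F.P K).d × Fin (F.P K).d) => j = 0 ∧ SideTouches ((cubeFam false (F.P K).L a M' ρ' (K - n)) 0) b.1 b.2 ∧ ¬ BondTouches ((cubeFam false (F.P K).L a M' ρ' (K - n)) 0) b.1 b.2) (fun b => A' b.1 b.2) ∧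
        msup (F.P K).L (K - n - 1) (((F.L : ℝ)⁻¹) ^ (K - n)) (-(2 : ℝ)) (fun j (t : Fin (F.P K).d × Fin (F.P K).d × LSite (F.P K).d) => SideTouches ((cubeFam false (F.P K).L a M' ρ' (K - n)) j) t.2.2 t.2.1) (fun t => covDerivFwd (((F.L : ℝ)⁻¹) ^ (K - n)) (1 : LSite (F.P K).d → Fin (F.P K).d → (Matrix (Fin 2) (Fin 2) ℂ)ˣ) t.1 (fun z => A' z t.2.1) t.2.2)
          ≤ B₀ * (bondNorm (F.P K).L (K - n - 1) (((F.L : ℝ)⁻¹) ^ (K - n)) (-(3 : ℝ)) (cubeFam false (F.P K).L a M' ρ' (K - n)) (fun x μ => Jcur (((F.L : ℝ)⁻¹) ^ (K - n)) (1 : LSite (F.P K).d → Fin (F.P K).d → (Matrix (Fin 2) (Fin 2) ℂ)ˣ) A' μ x)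
            + wsup 1 (fun p : {p : ℕ × (LSite (F.P K).d × Fin (F.P K).d) // p.1 ≤ K - n - 1 ∧ (p.2 ∈ (cubeLamBP' (F.P K).L a M' ρ' (K - n) (K - n - 1)) p.1 ∨ (p.1 = 0 ∧ CrossB ((cubeFam false (F.P K).L a M' ρ' (K - n)) 0) p.2))} => linCovIter (F.P K).L (1 : LSite (F.P K).d → Fin (F.P K).d → (Matrix (Fin 2) (Fin 2) ℂ)ˣ) (iEta (((F.L : ℝ)⁻¹) ^ (K - n)) A') p.1.1 p.1.2.1 p.1.2.2))
            + Bbd * msup (F.P K).L (K - n - 1) (((F.L : ℝ)⁻¹) ^ (K - n)) (-(1 : ℝ)) (fun j (b : LSite (F.P K).d × Fin (F.P K).d) => j = 0 ∧ SideTouches ((cubeFam false (F.P K).L a M' ρ' (K - n)) 0) b.1 b.2 ∧ ¬ BondTouches ((cubeFam false (F.P K).L a M' ρ' (K - n)) 0) b.1 b.2) (fun b => A' b.1 b.2)) := by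
  classical
  obtain ⟨Bs, ρ₀, M₀, N₀, R₀, hBs, H⟩ := HalvingH59GammaDischargeFlat.H59Dβm_holds_member L hL
  refine ⟨Bs, ρ₀, M₀, N₀, R₀, hBs, ?_⟩
  intro M' B₀ B₀'H B₂' BG BR cB9 Bbd hB hBbd hB₀'H hB₂' hBG hBR hcB9 F hF n K hnK ρ S M ρ' hρ'def h2 sx Rx hM₀ hdρ hdM hRρ hR₀ hN₀ hρ₀ _hM _hS a₅ Cr ε₀ ε₁ _hCr
    _hCr4 _h12 _hε₁ hε₀ _hε₀a _hCrε hw _hroom V _hV U _hU x₀ t _ht0 _ht a _hadef α₁ α₄ cstar hα₁def hcdef hα₄def s _hsdef W A' _hWu _hInAk hLan hsa hWA hA0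
  -- letters of the member and the window tuple `L·c⋆ ≤ 1∕12`, `0 ≤ c⋆`
  have hd3 : (F.P K).d = 3 := T3Family.P_d F K
  have hLF : (F.P K).L = F.L := rfl
  have hL2P : 2 ≤ (F.P K).L := by rw [hLF, hF]; omega
  have hLr : ((F.P K).L : ℝ) = (L : ℝ) := by rw [hLF, hF]
  have hB₀ : 0 < B₀ := lt_of_lt_of_le one_pos (hBs.trans hB)
  have hw' := hw
  rw [← hLr] at hw'
  subst hρ'def
  obtain ⟨m₀, α₀, α₁', a₆₆, cstar', B₀', α₄', C₂, cB, cA, cDA, c', σ, δ, ω, Cb, Cl, τ₀, e0, eα₀, ea, e1, ec, eB, e4, eC, ecB, ecA, ecDA, ecp, eσ, eδ, eω, eτ₀,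
    ⟨-, -, -, -, -, -, -, -, -, -, hc0', -⟩, ⟨-, h12', -⟩, -, -⟩ :=
    exists_topCall_constants_of_rhoWindow₃ (F.P K).d (F.P K).L hd3 hL2P hB₀ hB₀'H hB₂' hBG hBR hcB9 M' (ρ + M + L + S) hε₀ hw'
  have hα₁E : α₁ = α₁' := by rw [hα₁def, e1, hLr]
  have hcE : cstar = cstar' := by rw [hcdef, ec, eα₀, hα₁E]
  rw [← hcE] at hc0' h12'
  have hLP1 : (1 : ℝ) ≤ ((F.P K).L : ℝ) := by exact_mod_cast (le_trans (by norm_num) hL2P)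
  have hc : cstar ≤ 1 / 2 := by
    have h1 : cstar ≤ ((F.P K).L : ℝ) * cstar := le_mul_of_one_le_left hc0' hLP1
    linarith only [h1, h12']
  have hρL : L ≤ ρ + M + L + S := by omega
  exact H F hF n K hnK h2 a M' (ρ + M + L + S) sx Rx hρL hM₀ hdρ hdM hRρ hR₀ hN₀ hρ₀ B₀ Bbd cstar hB hBbd hc0' hc W hLan A' hsa hWA hA0

end Summit.QuantumFields.YangMills.Theorems.HalvingH59GammaDischargeFlatSplit

end
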